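import Summits.QuantumFields.YangMills.Theorems.BalabanUVNodesN18UniformDecayOfStepRate
import Summits.QuantumFields.BalabanUV.T4Continuum.Spine.NE9.MemoryFromRate

/-!
# BalabanUVNodes ∕ N18 — THE (5.10) TELESCOPE, KEYING-AGNOSTIC: k-UNIFORM decay from a SHIFT-form step letter on ANY SHIFT-CLOSED
# coupling set (box, run sets of a one-step map, …) and its passage to the whole box under FIRST-ENTRY-ONLY kernels
# (Track A, DAG node N18 = NE5 `T4OutputRate.NE5`; cluster K4 «SpineRates»; key K3⁸ `SpineGivenEndpointR13SepCoPHV` = stmt-QuantumFields-27366,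
# skeleton v6 b4e55110ab73e679; width seat `pub-ymgap-dag-n18-w4` g6, FILE 9 of the seat's kernel-currency lineage (FILE 5 = p615806
# `…N18UniformDecayOfStepRate`); `--kind proof --supports stmt-QuantumFields-27366 --as helper`, COUNT-NEUTRAL)

HONEST FRAMING.  A MECHANISM (downward telescope over the levels) in HYPOTHESIS FORM over landed definitions BY NAME.  The step letter (box-keyed
W1-19b `KernelStepRate` ∕ `WindowedStepRate`, or the SHIFT ∕ RUN-keyed inline shapes below), the LEVEL-0 decay row and the FIRST-ENTRY-ONLY property (FE) are
DISPLAYED hypotheses, asserted and inhabited nowhere (A6: jointly satisfiable at model level by the zero term family; LOCATED — their content is [Balaban1987RG1]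
Thm 1 p. 259 ∕ (5.10) p. 293, and NE5 is NOT PRINTED for d = 4).  Nothing of Bałaban's is asserted; N18 ∕ (D4) NOT discharged; NOT a proof of `stub_rates13HV` ∕
`stub_expansion13HV`; K3⁸ OPEN, not claimed; counts UNMOVED (typed 28∕28 · discharged 5∕27 (A 5∕28)).  One finite four-torus programme at fixed `ε`, Bałaban AS
PRINTED; R4 closes the conditional finite-𝕋⁴ rung `BalabanLadder.UV` only — NOT ℝ⁴, NOT infinite volume, NOT OS, NOT a mass gap, NOT Clay; no summit statement is
proved by this seat.  THEOREMS ONLY: 0 `def`, 0 `instance`, 0 `sorry`, standard axioms.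

WHY.  FILE 5 (§2–§3 there) derives the k-UNIFORM (5.10) rows (`DecayBound (EA …) (Window γ)`, `KernelDecay`, W1-19c `WindowedDecayUniform`) from node N18's
BOX-keyed step letter `KernelStepRate F ℰ ρ bV γ κ θ C₅` (`|Π_k(g) − Π_{k+1}(b, g)| ≤ C₅θ^{k+1}e^{−κ|z|₁}` for EVERY `b ∈ ]0, γ]` and EVERY `g ∈ ]0, γ]^ℕ`) plus
the level-0 row.  The ym-nodeO F-E finding (IDEA-1 ∕ CRIT-1 ∕ CRIT-2; dag-n18-w1 g6's `…N18KernelLettersFirstEntryOnly`, announced 2026-08-28) makes the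
BOX keying suspect at the kernels of record (under FE the box letter forces the kernels coupling-blind to geometric order) and locates the repair «key NE5 on
RUNS» (R-N18-RUN): run B's prepended coupling `b` and run A's first coupling `g 0` tied by a one-step map, `g 0 = nx b`.  The telescope does not care: all it
uses is that comparing level `k + 1` at `g` with level `k` at the SHIFTED sequence `g ∘ succ` stays inside the coupling set.  So this file re-types FILE 5's
mechanism ONCE for an ARBITRARY SHIFT-CLOSED set `W` (`∀ g ∈ W, (g ∘ succ) ∈ W`, an inline hypothesis — no definition) with the step letter in SHIFT form
`∀ g ∈ W, |Π_k(g ∘ succ; z) − Π_{k+1}(g; z)| ≤ C₅θ^{k+1}e^{−κ|z|₁}`: on `W := Window γ` the shift letter IS W1-19b's box letter (§2, `Iff`); on the RUN SET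
`{g ∈ Window γ | ∀ i, g (i+1) = nx (g i)}` of a one-step map `nx` (shift-closed by construction) it FOLLOWS from the run-keyed shape (§3); and under kernel-level FE
(§4) decay along the runs of ANY window-preserving `nx` gives decay on the WHOLE box, because every first entry `b ∈ ]0, γ]` starts the `nx`-orbit, which lies in
the run set — i.e. the (UD)∕(D4) `hdec` row the K3 bills read through FILE 5 survives a run re-keying of N18's letter under FE.  §5 is the finite-volume twin
(W1-19c on a shift-closed `W`; the volume shift `K ↦ K + s` absorbed by FILE 5's `eventually_atTop_of_eventually_add`).

WHAT.  §1 shift-closed sets (the box itself is shift-closed BY NAME: `Spine.NE9.MemoryFromRate.shift_mem_window`): `runSet_shift_mem` · `orbit_mem_runSet`.  §2 limiting (1.21) kernels of ANY term family `ℰ` on a shift-closed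
`W`: `shiftStepRate_iff_prependStepRate` · `shiftStepRate_window_iff_kernelStepRate` · ★ `abs_kernelA_le_of_shiftStepRate_of_base` · ★ `decayBound_EA_of_shiftStepRate_of_base`
· `kernelDecay_of_shiftStepRate_of_base`.  §3 run sets: `shiftStepRate_runSet_of_runStepRate` · ★ `decayBound_EA_runSet_of_runStepRate_of_base` ·
`kernelDecay_runSet_of_runStepRate_of_base`.  §4 first-entry-only kernels: `decayBound_EA_window_of_decayBound_of_firstEntries` ·
★ `decayBound_EA_window_of_runStepRate_of_base_of_firstEntryOnly` · `kernelDecay_window_of_runStepRate_of_base_of_firstEntryOnly`.  §5 finite volume: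
`polWindow_eventually_le_of_shiftWindowedStepRate_of_base` · ★ `windowedDecayUniform_of_shiftWindowedStepRate_of_base` · `decayBound_EA_of_shiftWindowedStepRate_of_base`.

Sources (TYPES and the mechanism only): T. Bałaban, Commun. Math. Phys. **109** (1987) 249–301 [Balaban1987RG1] — Thm 1 p. 259 (two runs, «the sequence of
the effective coupling constants is contained in an interval ]0, γ]», «uniform in the lattice spacing ε»), (0.18) p. 255 (the runs), (1.18) p. 263, (1.20)–(1.22)
p. 264, (5.10) p. 293; C. King, Commun. Math. Phys. **102** (1986) 649–677 [King1986] — Lemma 4.5 (4.38) p. 674 (printed one-step sibling).  No claim about the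
mass gap.
-/

noncomputable section

open Filter Topology
open scoped BigOperators

namespace YMDAG.N18.UniformDecayOfShiftStepRate

open Literature.MathematicalPhysics.QuantumFieldTheory.Balaban1983to89
open Literature.MathematicalPhysics.QuantumFieldTheory.Balaban1983to89.T4Continuum (T4Family)
open Literature.MathematicalPhysics.QuantumFieldTheory.Balaban1983to89.T4OutputRate (Window DecayBound mem_window)
open Literature.MathematicalPhysics.QuantumFieldTheory.Balaban1983to89.B12Sec2to5 (l1 l1_nonneg Decay510)
open Node00 (TermFamily1 polWindow prependCoupling prependCoupling_zero prependCoupling_succ)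
open Node00.U3OfKernels (histPrefix kernelA kernelA_congr EA decayBound_EA_iff KernelDecay kernelDecay_of_decayBound)
open Node00.U3KernelLetters (KernelStepRate PolLimitsExist)
open Node00.U3KernelLetters2 (WindowedDecayUniform)
open YMDAG.N18.UniformDecayOfStepRate (sum_range_pow_succ_le eventually_atTop_of_eventually_add prependCoupling_head_tail tail_histPrefix_succ)
open YMDAG.N18.KernelLettersJunctions (decayBound_EA_of_windowedDecayUniform)
open Summit.QuantumFields.BalabanUV.T4Continuum.NE9.MemoryFromRate (shift_mem_window)

/-! ## §1 Shift-closed coupling sets: the run sets of a one-step map (the box `]0, γ]^ℕ` is shift-closed by `Spine.NE9.MemoryFromRate.shift_mem_window`) -/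

/-- The RUN SET of a one-step map `nx` — the sequences of the window generated by `nx`, `g_{i+1} = nx g_i` — is SHIFT-CLOSED (inline set, no definition).
[cite: Balaban1987RG1, (0.18) p.255 and Thm 1 p.259 (the runs; bookkeeping)] -/
theorem runSet_shift_mem {γ : ℝ} {nx : ℝ → ℝ} {g : ℕ → ℝ} (hg : g ∈ {g : ℕ → ℝ | g ∈ Window γ ∧ ∀ i, g (i + 1) = nx (g i)}) :
    (fun i => g (i + 1)) ∈ {g : ℕ → ℝ | g ∈ Window γ ∧ ∀ i, g (i + 1) = nx (g i)} :=
  ⟨shift_mem_window hg.1, fun i => hg.2 (i + 1)⟩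

/-- Every first coupling `b ∈ ]0, γ]` STARTS A RUN: if `nx` maps `]0, γ]` into itself, the orbit `(b, nx b, nx (nx b), …)` lies in the run set of `nx` and has first
entry `b`. [cite: Balaban1987RG1, (0.18) p.255 and Thm 1 p.259 (the runs; bookkeeping)] -/
theorem orbit_mem_runSet {γ : ℝ} {nx : ℝ → ℝ} (hnx : ∀ b : ℝ, 0 < b → b ≤ γ → 0 < nx b ∧ nx b ≤ γ) {b : ℝ} (hb : 0 < b) (hbγ : b ≤ γ) :
    (fun i => nx^[i] b) ∈ {g : ℕ → ℝ | g ∈ Window γ ∧ ∀ i, g (i + 1) = nx (g i)} ∧ (fun i => nx^[i] b) 0 = b := by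
  refine ⟨⟨fun i => ?_, fun i => ?_⟩, rfl⟩
  · induction i with
    | zero => exact ⟨hb, hbγ⟩
    | succ i ih =>
      have h := hnx _ ih.1 ih.2
      simpa only [Function.iterate_succ_apply'] using h
  · simp only [Function.iterate_succ_apply']

/-! ## §2 Limiting (1.21) kernels of a term family: the telescope on a shift-closed set with the step letter in SHIFT form -/

section Limiting

variable {𝔄 : Type*} [NormedRing 𝔄] [NormedAlgebra ℝ 𝔄]
variable {V : Type*} [NormedAddCommGroup V] [NormedSpace ℝ V] {ι : Type*} [Fintype ι]
variable (F : T4Family) {ℰ : TermFamily1 F 𝔄} (ρ : V →L[ℝ] 𝔄) (bV : Module.Basis ι ℝ V)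

/-- **SHIFT FORM ⟺ PREPEND FORM** of a step letter on ANY coupling set `W` (no closure needed): bounding `|Π_k(g ∘ succ) − Π_{k+1}(g)|` at every `g ∈ W` is the
same as bounding `|Π_k(g) − Π_{k+1}(b, g)|` at every pair `(b, g)` whose prepended sequence lies in `W` (`(b, g) = (h 0, h ∘ succ)` for `h := prependCoupling b g`).
[cite: Balaban1987RG1, Thm 1 p.259 and (0.24)–(0.25) p.257 (re-indexing; bookkeeping)] -/
theorem shiftStepRate_iff_prependStepRate (W : Set (ℕ → ℝ)) (B : ℕ → (Fin 4 → ℤ) → ℝ) :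
    (∀ g ∈ W, ∀ (k : ℕ) (μ ν : Fin 4) (z : Fin 4 → ℤ),
        |kernelA F ℰ ρ bV (fun i => g (i + 1)) k μ ν z - kernelA F ℰ ρ bV g (k + 1) μ ν z| ≤ B k z) ↔
      ∀ (b : ℝ) (g : ℕ → ℝ), prependCoupling b g ∈ W → ∀ (k : ℕ) (μ ν : Fin 4) (z : Fin 4 → ℤ),
        |kernelA F ℰ ρ bV g k μ ν z - kernelA F ℰ ρ bV (prependCoupling b g) (k + 1) μ ν z| ≤ B k z := by
  constructor
  · intro h b g hbg k μ ν z
    simpa only [prependCoupling_succ] using h _ hbg k μ ν z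
  · intro h g hg k μ ν z
    have h' := h (g 0) (fun i => g (i + 1)) (by rwa [prependCoupling_head_tail]) k μ ν z
    rwa [prependCoupling_head_tail] at h'

/-- **ON THE BOX THE SHIFT LETTER IS W1-19b's `KernelStepRate`**: `]0, γ]^ℕ` is closed under prepending any `b ∈ ]0, γ]` and under the shift, so the two keyings
agree. [cite: Balaban1987RG1, Thm 1 p.259 (bookkeeping; the estimate itself is NOT asserted)] -/
theorem shiftStepRate_window_iff_kernelStepRate (γ κ θ C₅ : ℝ) :
    (∀ g ∈ Window γ, ∀ (k : ℕ) (μ ν : Fin 4) (z : Fin 4 → ℤ),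
        |kernelA F ℰ ρ bV (fun i => g (i + 1)) k μ ν z - kernelA F ℰ ρ bV g (k + 1) μ ν z| ≤ C₅ * θ ^ (k + 1) * Real.exp (-(κ * l1 z))) ↔
      KernelStepRate F ℰ ρ bV γ κ θ C₅ := by
  rw [shiftStepRate_iff_prependStepRate]
  constructor
  · intro h b hb hbγ g hg k μ ν z
    exact h b g (Node00.U3OfKernels.prependCoupling_mem_window hb hbγ hg) k μ ν z
  · intro h b g hbg k μ ν z
    have hb : 0 < b ∧ b ≤ γ := by simpa only [prependCoupling_zero] using mem_window.1 hbg 0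
    exact h b hb.1 hb.2 g (fun i => by simpa only [prependCoupling_succ] using mem_window.1 hbg (i + 1)) k μ ν z

/-- **THE TELESCOPE ON A SHIFT-CLOSED SET**: the shift-form step letter `|Π_k(g ∘ succ; z) − Π_{k+1}(g; z)| ≤ C₅θ^{k+1}e^{−κ|z|₁}` on `W`, `W` closed under the
shift, and a level-0 (5.10) bound with constant `E₀` on `W` give `|Π_k(g; z)| ≤ (E₀ + C₅ Σ_{j<k} θ^{j+1}) e^{−κ|z|₁}` for every `g ∈ W` — level `k + 1` at `g` against
level `k` at `g ∘ succ ∈ W`, down to level `0`. [cite: Balaban1987RG1, Thm 1 p.259 and (5.10) p.293 (mechanism; nothing of the source asserted)] -/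
theorem abs_kernelA_le_of_shiftStepRate_of_base {W : Set (ℕ → ℝ)} {κ θ C₅ E₀ : ℝ} (hW : ∀ g ∈ W, (fun i => g (i + 1)) ∈ W)
    (hstep : ∀ g ∈ W, ∀ (k : ℕ) (μ ν : Fin 4) (z : Fin 4 → ℤ),
      |kernelA F ℰ ρ bV (fun i => g (i + 1)) k μ ν z - kernelA F ℰ ρ bV g (k + 1) μ ν z| ≤ C₅ * θ ^ (k + 1) * Real.exp (-(κ * l1 z)))
    (h0 : ∀ g ∈ W, ∀ (μ ν : Fin 4), Decay510 (kernelA F ℰ ρ bV g 0 μ ν) E₀ κ)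
    (k : ℕ) {g : ℕ → ℝ} (hg : g ∈ W) (μ ν : Fin 4) (z : Fin 4 → ℤ) :
    |kernelA F ℰ ρ bV g k μ ν z| ≤ (E₀ + C₅ * ∑ j ∈ Finset.range k, θ ^ (j + 1)) * Real.exp (-(κ * l1 z)) := by
  induction k generalizing g with
  | zero =>
    have h := h0 g hg μ ν z
    rw [neg_mul] at h; simpa using h
  | succ k ih =>
    have hstep' := hstep g hg k μ ν z
    calc |kernelA F ℰ ρ bV g (k + 1) μ ν z|
        = |kernelA F ℰ ρ bV (fun i => g (i + 1)) k μ ν z -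
            (kernelA F ℰ ρ bV (fun i => g (i + 1)) k μ ν z - kernelA F ℰ ρ bV g (k + 1) μ ν z)| := by congr 1; ring
      _ ≤ |kernelA F ℰ ρ bV (fun i => g (i + 1)) k μ ν z| +
            |kernelA F ℰ ρ bV (fun i => g (i + 1)) k μ ν z - kernelA F ℰ ρ bV g (k + 1) μ ν z| := abs_sub _ _
      _ ≤ (E₀ + C₅ * ∑ j ∈ Finset.range k, θ ^ (j + 1)) * Real.exp (-(κ * l1 z)) + C₅ * θ ^ (k + 1) * Real.exp (-(κ * l1 z)) :=
        add_le_add (ih (hW g hg)) hstep'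
      _ = (E₀ + C₅ * ∑ j ∈ Finset.range (k + 1), θ ^ (j + 1)) * Real.exp (-(κ * l1 z)) := by
        rw [Finset.sum_range_succ]; ring

/-- ★ **NODE U3's DECAY SLOT ON A SHIFT-CLOSED SET FROM THE SHIFT LETTER + THE LEVEL-0 ROW**: with `0 ≤ C₅`, `0 ≤ θ < 1`, ONE constant `E₀ + C₅·θ∕(1−θ)`
bounds the limiting kernels of EVERY level at EVERY sequence of `W` — `DecayBound (EA F ℰ ρ bV) W (E₀ + C₅·(θ∕(1−θ))) κ` — whatever the keying `W` (box, run set, …).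
[cite: Balaban1987RG1, (1.18) p.263, Thm 1 p.259 and (5.10) p.293 (mechanism; nothing of the source asserted)] -/
theorem decayBound_EA_of_shiftStepRate_of_base {W : Set (ℕ → ℝ)} {κ θ C₅ E₀ : ℝ} (hθ0 : 0 ≤ θ) (hθ1 : θ < 1) (hC₅ : 0 ≤ C₅)
    (hW : ∀ g ∈ W, (fun i => g (i + 1)) ∈ W)
    (hstep : ∀ g ∈ W, ∀ (k : ℕ) (μ ν : Fin 4) (z : Fin 4 → ℤ),
      |kernelA F ℰ ρ bV (fun i => g (i + 1)) k μ ν z - kernelA F ℰ ρ bV g (k + 1) μ ν z| ≤ C₅ * θ ^ (k + 1) * Real.exp (-(κ * l1 z)))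
    (h0 : ∀ g ∈ W, ∀ (μ ν : Fin 4), Decay510 (kernelA F ℰ ρ bV g 0 μ ν) E₀ κ) :
    DecayBound (EA F ℰ ρ bV) W (E₀ + C₅ * (θ / (1 - θ))) κ :=
  (decayBound_EA_iff F ℰ ρ bV W _ κ).2 fun g hg k μ ν z => by
    rw [neg_mul]
    refine (abs_kernelA_le_of_shiftStepRate_of_base F ρ bV hW hstep h0 k hg μ ν z).trans (mul_le_mul_of_nonneg_right ?_ (Real.exp_pos _).le)
    exact add_le_add le_rfl (mul_le_mul_of_nonneg_left (sum_range_pow_succ_le hθ0 hθ1 k) hC₅)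

/-- W1-19's `KernelDecay` on a shift-closed set ((D4)'s `hdec` class) in EVERY direction pair from the shift letter + the level-0 row.
[cite: Balaban1987RG1, (5.10) p.293 (mechanism; nothing of the source asserted)] -/
theorem kernelDecay_of_shiftStepRate_of_base {W : Set (ℕ → ℝ)} {κ θ C₅ E₀ : ℝ} (hθ0 : 0 ≤ θ) (hθ1 : θ < 1) (hC₅ : 0 ≤ C₅)
    (hW : ∀ g ∈ W, (fun i => g (i + 1)) ∈ W)
    (hstep : ∀ g ∈ W, ∀ (k : ℕ) (μ ν : Fin 4) (z : Fin 4 → ℤ),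
      |kernelA F ℰ ρ bV (fun i => g (i + 1)) k μ ν z - kernelA F ℰ ρ bV g (k + 1) μ ν z| ≤ C₅ * θ ^ (k + 1) * Real.exp (-(κ * l1 z)))
    (h0 : ∀ g ∈ W, ∀ (μ ν : Fin 4), Decay510 (kernelA F ℰ ρ bV g 0 μ ν) E₀ κ) (μ ν : Fin 4) :
    KernelDecay F ℰ ρ bV W μ ν κ :=
  kernelDecay_of_decayBound F ℰ ρ bV (decayBound_EA_of_shiftStepRate_of_base F ρ bV hθ0 hθ1 hC₅ hW hstep h0) μ ν

/-! ## §3 Run sets of a one-step map `nx`: the RUN-keyed step shape feeds the telescope -/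

/-- **THE RUN-KEYED STEP SHAPE GIVES THE SHIFT LETTER ON THE RUN SET.**  The run-keyed NE5 shape — run B's unpaired first coupling `b ∈ ]0, γ]` and run A's
sequence `g ∈ ]0, γ]^ℕ` tied by `g 0 = nx b` — bounds `|Π_k(h ∘ succ) − Π_{k+1}(h)|` at every `h` of the run set of `nx` (take `b := h 0`, `g := h ∘ succ`: `g 0 = h 1 = nx (h 0)`).
[cite: Balaban1987RG1, (0.18) p.255 and Thm 1 p.259 (the runs; re-indexing only — NE5 is NOT asserted)] -/
theorem shiftStepRate_runSet_of_runStepRate {γ : ℝ} {nx : ℝ → ℝ} (B : ℕ → (Fin 4 → ℤ) → ℝ)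
    (hrun : ∀ b : ℝ, 0 < b → b ≤ γ → ∀ g ∈ Window γ, g 0 = nx b → ∀ (k : ℕ) (μ ν : Fin 4) (z : Fin 4 → ℤ),
      |kernelA F ℰ ρ bV g k μ ν z - kernelA F ℰ ρ bV (prependCoupling b g) (k + 1) μ ν z| ≤ B k z) :
    ∀ h ∈ {g : ℕ → ℝ | g ∈ Window γ ∧ ∀ i, g (i + 1) = nx (g i)}, ∀ (k : ℕ) (μ ν : Fin 4) (z : Fin 4 → ℤ),
      |kernelA F ℰ ρ bV (fun i => h (i + 1)) k μ ν z - kernelA F ℰ ρ bV h (k + 1) μ ν z| ≤ B k z := by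
  intro h hh k μ ν z
  have hb : 0 < h 0 ∧ h 0 ≤ γ := mem_window.1 hh.1 0
  have h' := hrun (h 0) hb.1 hb.2 (fun i => h (i + 1)) (shift_mem_window hh.1) (hh.2 0) k μ ν z
  rwa [prependCoupling_head_tail] at h'

/-- ★ **DECAY ALONG THE RUNS FROM THE RUN-KEYED STEP SHAPE + THE LEVEL-0 ROW**: with `0 ≤ C₅`, `0 ≤ θ < 1`, the run-keyed NE5 shape and the level-0 (5.10) row on the
run set of `nx` give `DecayBound (EA F ℰ ρ bV) {g ∈ ]0, γ]^ℕ | g_{i+1} = nx g_i} (E₀ + C₅·θ∕(1−θ)) κ` — the k-UNIFORM (5.10) class at every run, with NO box-keyed letter.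
[cite: Balaban1987RG1, (0.18) p.255, Thm 1 p.259 and (5.10) p.293 (mechanism; nothing of the source asserted)] -/
theorem decayBound_EA_runSet_of_runStepRate_of_base {γ κ θ C₅ E₀ : ℝ} {nx : ℝ → ℝ} (hθ0 : 0 ≤ θ) (hθ1 : θ < 1) (hC₅ : 0 ≤ C₅)
    (hrun : ∀ b : ℝ, 0 < b → b ≤ γ → ∀ g ∈ Window γ, g 0 = nx b → ∀ (k : ℕ) (μ ν : Fin 4) (z : Fin 4 → ℤ),
      |kernelA F ℰ ρ bV g k μ ν z - kernelA F ℰ ρ bV (prependCoupling b g) (k + 1) μ ν z| ≤ C₅ * θ ^ (k + 1) * Real.exp (-(κ * l1 z)))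
    (h0 : ∀ g ∈ {g : ℕ → ℝ | g ∈ Window γ ∧ ∀ i, g (i + 1) = nx (g i)}, ∀ (μ ν : Fin 4), Decay510 (kernelA F ℰ ρ bV g 0 μ ν) E₀ κ) :
    DecayBound (EA F ℰ ρ bV) {g : ℕ → ℝ | g ∈ Window γ ∧ ∀ i, g (i + 1) = nx (g i)} (E₀ + C₅ * (θ / (1 - θ))) κ :=
  decayBound_EA_of_shiftStepRate_of_base F ρ bV hθ0 hθ1 hC₅ (fun _ hg => runSet_shift_mem hg)
    (shiftStepRate_runSet_of_runStepRate F ρ bV _ hrun) h0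

/-- W1-19's `KernelDecay` ON THE RUN SET from the run-keyed step shape + the level-0 row, every direction pair.
[cite: Balaban1987RG1, (5.10) p.293 (mechanism; nothing of the source asserted)] -/
theorem kernelDecay_runSet_of_runStepRate_of_base {γ κ θ C₅ E₀ : ℝ} {nx : ℝ → ℝ} (hθ0 : 0 ≤ θ) (hθ1 : θ < 1) (hC₅ : 0 ≤ C₅)
    (hrun : ∀ b : ℝ, 0 < b → b ≤ γ → ∀ g ∈ Window γ, g 0 = nx b → ∀ (k : ℕ) (μ ν : Fin 4) (z : Fin 4 → ℤ),
      |kernelA F ℰ ρ bV g k μ ν z - kernelA F ℰ ρ bV (prependCoupling b g) (k + 1) μ ν z| ≤ C₅ * θ ^ (k + 1) * Real.exp (-(κ * l1 z)))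
    (h0 : ∀ g ∈ {g : ℕ → ℝ | g ∈ Window γ ∧ ∀ i, g (i + 1) = nx (g i)}, ∀ (μ ν : Fin 4), Decay510 (kernelA F ℰ ρ bV g 0 μ ν) E₀ κ)
    (μ ν : Fin 4) : KernelDecay F ℰ ρ bV {g : ℕ → ℝ | g ∈ Window γ ∧ ∀ i, g (i + 1) = nx (g i)} μ ν κ :=
  kernelDecay_of_decayBound F ℰ ρ bV (decayBound_EA_runSet_of_runStepRate_of_base F ρ bV hθ0 hθ1 hC₅ hrun h0) μ ν

/-! ## §4 First-entry-only kernels: decay along the runs of a window-preserving map is decay on the whole box -/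

/-- **DECAY ON A SET MEETING EVERY FIRST ENTRY IS DECAY ON THE BOX, UNDER FE.**  If the limiting kernels are FIRST-ENTRY-ONLY on the box (the DISPLAYED hypothesis
`hFE`: two sequences of the window with the same first coupling have the same kernels at every level), then a uniform decay bound on any `W ⊆ ]0, γ]^ℕ` through which
every `b ∈ ]0, γ]` occurs as a first entry is the same bound on the whole box. [cite: Balaban1987RG1, (1.18) p.263 and (5.10) p.293 (bookkeeping; FE is NOT asserted)] -/
theorem decayBound_EA_window_of_decayBound_of_firstEntries {γ E₀ κ : ℝ} {W : Set (ℕ → ℝ)} (hWγ : W ⊆ Window γ)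
    (hfirst : ∀ b : ℝ, 0 < b → b ≤ γ → ∃ g ∈ W, g 0 = b)
    (hFE : ∀ g ∈ Window γ, ∀ g' ∈ Window γ, g 0 = g' 0 → ∀ (k : ℕ) (μ ν : Fin 4) (z : Fin 4 → ℤ),
      kernelA F ℰ ρ bV g k μ ν z = kernelA F ℰ ρ bV g' k μ ν z)
    (hD : DecayBound (EA F ℰ ρ bV) W E₀ κ) : DecayBound (EA F ℰ ρ bV) (Window γ) E₀ κ :=
  (decayBound_EA_iff F ℰ ρ bV (Window γ) E₀ κ).2 fun g hg k μ ν z => by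
    have hb : 0 < g 0 ∧ g 0 ≤ γ := mem_window.1 hg 0
    obtain ⟨g', hg'W, hg'0⟩ := hfirst (g 0) hb.1 hb.2
    rw [hFE g hg g' (hWγ hg'W) hg'0.symm k μ ν z]
    exact (decayBound_EA_iff F ℰ ρ bV W E₀ κ).1 hD g' hg'W k μ ν z

/-- ★ **UNDER FE, THE RUN-KEYED STEP SHAPE + THE LEVEL-0 ROW GIVE THE k-UNIFORM (5.10) CLASS ON THE WHOLE BOX.**  For ANY one-step map `nx` sending `]0, γ]` into
itself: run-keyed NE5 (`g 0 = nx b`), the level-0 row on the box, `0 ≤ C₅`, `0 ≤ θ < 1` and first-entry-only kernels give `DecayBound (EA F ℰ ρ bV) (Window γ)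
(E₀ + C₅·θ∕(1−θ)) κ` — the row FILE 5 derived from the BOX-keyed letter, now from the RUN-keyed one (every `b ∈ ]0, γ]` starts the `nx`-orbit, a run).
[cite: Balaban1987RG1, (0.18) p.255, Thm 1 p.259, (1.18) p.263 and (5.10) p.293 (mechanism; NE5 ∕ FE NOT asserted)] -/
theorem decayBound_EA_window_of_runStepRate_of_base_of_firstEntryOnly {γ κ θ C₅ E₀ : ℝ} {nx : ℝ → ℝ} (hθ0 : 0 ≤ θ) (hθ1 : θ < 1) (hC₅ : 0 ≤ C₅)
    (hnx : ∀ b : ℝ, 0 < b → b ≤ γ → 0 < nx b ∧ nx b ≤ γ)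
    (hrun : ∀ b : ℝ, 0 < b → b ≤ γ → ∀ g ∈ Window γ, g 0 = nx b → ∀ (k : ℕ) (μ ν : Fin 4) (z : Fin 4 → ℤ),
      |kernelA F ℰ ρ bV g k μ ν z - kernelA F ℰ ρ bV (prependCoupling b g) (k + 1) μ ν z| ≤ C₅ * θ ^ (k + 1) * Real.exp (-(κ * l1 z)))
    (h0 : ∀ g ∈ Window γ, ∀ (μ ν : Fin 4), Decay510 (kernelA F ℰ ρ bV g 0 μ ν) E₀ κ)
    (hFE : ∀ g ∈ Window γ, ∀ g' ∈ Window γ, g 0 = g' 0 → ∀ (k : ℕ) (μ ν : Fin 4) (z : Fin 4 → ℤ),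
      kernelA F ℰ ρ bV g k μ ν z = kernelA F ℰ ρ bV g' k μ ν z) :
    DecayBound (EA F ℰ ρ bV) (Window γ) (E₀ + C₅ * (θ / (1 - θ))) κ :=
  decayBound_EA_window_of_decayBound_of_firstEntries F ρ bV (fun _ hg => hg.1)
    (fun b hb hbγ => ⟨fun i => nx^[i] b, (orbit_mem_runSet hnx hb hbγ).1, (orbit_mem_runSet hnx hb hbγ).2⟩) hFE
    (decayBound_EA_runSet_of_runStepRate_of_base F ρ bV hθ0 hθ1 hC₅ hrun fun g hg => h0 g hg.1)

/-- W1-19's `KernelDecay` ON THE WHOLE BOX ((D4)'s `hdec` class at `Window γ`) from the RUN-keyed step shape + the level-0 row, under FE, every direction pair.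
[cite: Balaban1987RG1, (5.10) p.293 (mechanism; NE5 ∕ FE NOT asserted)] -/
theorem kernelDecay_window_of_runStepRate_of_base_of_firstEntryOnly {γ κ θ C₅ E₀ : ℝ} {nx : ℝ → ℝ} (hθ0 : 0 ≤ θ) (hθ1 : θ < 1) (hC₅ : 0 ≤ C₅)
    (hnx : ∀ b : ℝ, 0 < b → b ≤ γ → 0 < nx b ∧ nx b ≤ γ)
    (hrun : ∀ b : ℝ, 0 < b → b ≤ γ → ∀ g ∈ Window γ, g 0 = nx b → ∀ (k : ℕ) (μ ν : Fin 4) (z : Fin 4 → ℤ),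
      |kernelA F ℰ ρ bV g k μ ν z - kernelA F ℰ ρ bV (prependCoupling b g) (k + 1) μ ν z| ≤ C₅ * θ ^ (k + 1) * Real.exp (-(κ * l1 z)))
    (h0 : ∀ g ∈ Window γ, ∀ (μ ν : Fin 4), Decay510 (kernelA F ℰ ρ bV g 0 μ ν) E₀ κ)
    (hFE : ∀ g ∈ Window γ, ∀ g' ∈ Window γ, g 0 = g' 0 → ∀ (k : ℕ) (μ ν : Fin 4) (z : Fin 4 → ℤ),
      kernelA F ℰ ρ bV g k μ ν z = kernelA F ℰ ρ bV g' k μ ν z) (μ ν : Fin 4) :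
    KernelDecay F ℰ ρ bV (Window γ) μ ν κ :=
  kernelDecay_of_decayBound F ℰ ρ bV
    (decayBound_EA_window_of_runStepRate_of_base_of_firstEntryOnly F ρ bV hθ0 hθ1 hC₅ hnx hrun h0 hFE) μ ν

end Limiting

/-! ## §5 Finite volume: W1-19c's uniform windowed decay on a shift-closed set from a SHIFT-form windowed step letter + the level-0 windowed row -/

section FiniteVolume

variable {𝔄 : Type*} [NormedRing 𝔄] [NormedAlgebra ℝ 𝔄]
variable {V : Type*} [NormedAddCommGroup V] [NormedSpace ℝ V] {ι : Type*} [Fintype ι]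
variable (F : T4Family) {ℰ : TermFamily1 F 𝔄} (ρ : V →L[ℝ] 𝔄) (bV : Module.Basis ι ℝ V)

/-- **THE TELESCOPE AT FINITE VOLUME ON A SHIFT-CLOSED SET**: a SHIFT-form windowed step letter on `W` — run B at approximation `K + s`, level `k + 2`, prefix of `g`,
against run A at approximation `K`, level `k + 1`, prefix of `g ∘ succ`, eventually `C′θ^k e^{−κ|x|₁}`-close — and a level-0 windowed bound with constant `E₀` on `W`
(both EVENTUALLY in `K`) give `|Π^{(K)}_{k+1}(g_0, …, g_k; x)| ≤ (E₀ + C′ Σ_{j<k} θ^j) e^{−κ|x|₁}` eventually in `K`, for every `g ∈ W`; the per-level volume shift `K ↦ K + s`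
is absorbed by FILE 5's `eventually_atTop_of_eventually_add`. [cite: Balaban1987RG1, Thm 1 p.259, (1.20) p.264 and (5.10) p.293 (mechanism; nothing of the source asserted)] -/
theorem polWindow_eventually_le_of_shiftWindowedStepRate_of_base {W : Set (ℕ → ℝ)} {κ θ C' E₀ : ℝ} {s : ℕ} (hW : ∀ g ∈ W, (fun i => g (i + 1)) ∈ W)
    (hS : ∀ g ∈ W, ∀ (k : ℕ) (μ ν : Fin 4) (x : Fin 4 → ℤ), ∀ᶠ K in atTop,
      |polWindow F (K + s) (k + 1 + 1) (ℰ (k + 1) (histPrefix g (k + 1)) (K + s)) ρ bV μ ν x -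
          polWindow F K (k + 1) (ℰ k (histPrefix (fun i => g (i + 1)) k) K) ρ bV μ ν x| ≤ C' * θ ^ k * Real.exp (-κ * l1 x))
    (h0 : ∀ g ∈ W, ∀ (μ ν : Fin 4) (x : Fin 4 → ℤ), ∀ᶠ K in atTop, |polWindow F K 1 (ℰ 0 (histPrefix g 0) K) ρ bV μ ν x| ≤ E₀ * Real.exp (-κ * l1 x))
    (k : ℕ) {g : ℕ → ℝ} (hg : g ∈ W) (μ ν : Fin 4) (x : Fin 4 → ℤ) :
    ∀ᶠ K in atTop, |polWindow F K (k + 1) (ℰ k (histPrefix g k) K) ρ bV μ ν x| ≤ (E₀ + C' * ∑ j ∈ Finset.range k, θ ^ j) * Real.exp (-κ * l1 x) := by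
  induction k generalizing g with
  | zero => simpa using h0 g hg μ ν x
  | succ k ih =>
    refine eventually_atTop_of_eventually_add
      (fun K => |polWindow F K (k + 1 + 1) (ℰ (k + 1) (histPrefix g (k + 1)) K) ρ bV μ ν x| ≤
        (E₀ + C' * ∑ j ∈ Finset.range (k + 1), θ ^ j) * Real.exp (-κ * l1 x)) s ?_
    filter_upwards [hS g hg k μ ν x, ih (hW g hg)] with K hK hih
    calc |polWindow F (K + s) (k + 1 + 1) (ℰ (k + 1) (histPrefix g (k + 1)) (K + s)) ρ bV μ ν x|
        = |polWindow F K (k + 1) (ℰ k (histPrefix (fun i => g (i + 1)) k) K) ρ bV μ ν x +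
            (polWindow F (K + s) (k + 1 + 1) (ℰ (k + 1) (histPrefix g (k + 1)) (K + s)) ρ bV μ ν x -
              polWindow F K (k + 1) (ℰ k (histPrefix (fun i => g (i + 1)) k) K) ρ bV μ ν x)| := by congr 1; ring
      _ ≤ |polWindow F K (k + 1) (ℰ k (histPrefix (fun i => g (i + 1)) k) K) ρ bV μ ν x| +
            |polWindow F (K + s) (k + 1 + 1) (ℰ (k + 1) (histPrefix g (k + 1)) (K + s)) ρ bV μ ν x -
              polWindow F K (k + 1) (ℰ k (histPrefix (fun i => g (i + 1)) k) K) ρ bV μ ν x| := abs_add_le _ _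
      _ ≤ (E₀ + C' * ∑ j ∈ Finset.range k, θ ^ j) * Real.exp (-κ * l1 x) + C' * θ ^ k * Real.exp (-κ * l1 x) := add_le_add hih hK
      _ = (E₀ + C' * ∑ j ∈ Finset.range (k + 1), θ ^ j) * Real.exp (-κ * l1 x) := by
        rw [Finset.sum_range_succ]; ring

/-- ★ **W1-19c's `WindowedDecayUniform` ON A SHIFT-CLOSED SET FROM THE SHIFT-FORM WINDOWED STEP LETTER + THE LEVEL-0 WINDOWED ROW**: with `0 ≤ C′`, `0 ≤ θ < 1`,
ONE constant `E₀ + C′∕(1−θ)` bounds the windowed kernels of EVERY level at EVERY sequence of `W`, eventually in `K`.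
[cite: Balaban1987RG1, Thm 1 p.259, (1.20) p.264 and (5.10) p.293 (mechanism; nothing of the source asserted)] -/
theorem windowedDecayUniform_of_shiftWindowedStepRate_of_base {W : Set (ℕ → ℝ)} {κ θ C' E₀ : ℝ} {s : ℕ} (hθ0 : 0 ≤ θ) (hθ1 : θ < 1) (hC' : 0 ≤ C')
    (hW : ∀ g ∈ W, (fun i => g (i + 1)) ∈ W)
    (hS : ∀ g ∈ W, ∀ (k : ℕ) (μ ν : Fin 4) (x : Fin 4 → ℤ), ∀ᶠ K in atTop,
      |polWindow F (K + s) (k + 1 + 1) (ℰ (k + 1) (histPrefix g (k + 1)) (K + s)) ρ bV μ ν x -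
          polWindow F K (k + 1) (ℰ k (histPrefix (fun i => g (i + 1)) k) K) ρ bV μ ν x| ≤ C' * θ ^ k * Real.exp (-κ * l1 x))
    (h0 : ∀ g ∈ W, ∀ (μ ν : Fin 4) (x : Fin 4 → ℤ), ∀ᶠ K in atTop, |polWindow F K 1 (ℰ 0 (histPrefix g 0) K) ρ bV μ ν x| ≤ E₀ * Real.exp (-κ * l1 x)) :
    WindowedDecayUniform F ℰ ρ bV W (E₀ + C' / (1 - θ)) κ := fun g hg k μ ν x => by
  filter_upwards [polWindow_eventually_le_of_shiftWindowedStepRate_of_base F ρ bV hW hS h0 k hg μ ν x] with K hK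
  refine hK.trans (mul_le_mul_of_nonneg_right ?_ (Real.exp_pos _).le)
  rw [div_eq_mul_inv]
  exact add_le_add le_rfl (mul_le_mul_of_nonneg_left (sum_le_hasSum _ (fun j _ => pow_nonneg hθ0 j) (hasSum_geometric_of_lt_one hθ0 hθ1)) hC')

/-- **NODE U3's DECAY SLOT ON A SHIFT-CLOSED SET FROM (1.21)-EXISTENCE + THE SHIFT-FORM WINDOWED STEP LETTER + THE LEVEL-0 WINDOWED ROW** (dag-n18-w1's
`decayBound_EA_of_windowedDecayUniform` after the finite-volume telescope; `le_of_tendsto` lives there). [cite: Balaban1987RG1, (1.18) p.263, (1.21) p.264 and (5.10) p.293 (mechanism)] -/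
theorem decayBound_EA_of_shiftWindowedStepRate_of_base {W : Set (ℕ → ℝ)} {κ θ C' E₀ : ℝ} {s : ℕ} (hθ0 : 0 ≤ θ) (hθ1 : θ < 1) (hC' : 0 ≤ C')
    (hW : ∀ g ∈ W, (fun i => g (i + 1)) ∈ W) (hlim : PolLimitsExist F ℰ ρ bV W)
    (hS : ∀ g ∈ W, ∀ (k : ℕ) (μ ν : Fin 4) (x : Fin 4 → ℤ), ∀ᶠ K in atTop,
      |polWindow F (K + s) (k + 1 + 1) (ℰ (k + 1) (histPrefix g (k + 1)) (K + s)) ρ bV μ ν x -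
          polWindow F K (k + 1) (ℰ k (histPrefix (fun i => g (i + 1)) k) K) ρ bV μ ν x| ≤ C' * θ ^ k * Real.exp (-κ * l1 x))
    (h0 : ∀ g ∈ W, ∀ (μ ν : Fin 4) (x : Fin 4 → ℤ), ∀ᶠ K in atTop, |polWindow F K 1 (ℰ 0 (histPrefix g 0) K) ρ bV μ ν x| ≤ E₀ * Real.exp (-κ * l1 x)) :
    DecayBound (EA F ℰ ρ bV) W (E₀ + C' / (1 - θ)) κ :=
  decayBound_EA_of_windowedDecayUniform F ℰ ρ bV hlim (windowedDecayUniform_of_shiftWindowedStepRate_of_base F ρ bV hθ0 hθ1 hC' hW hS h0)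

end FiniteVolume

end YMDAG.N18.UniformDecayOfShiftStepRate
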